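import Summits.ValiantsHypothesis.ValiantsHypothesis.Theorems.KPlusLogSqLawWeakLiftingTowerGraftGraftFloorLemma
import Summits.ValiantsHypothesis.ValiantsHypothesis.Theorems.LacunarySymmetroidMatrixDescartesCensusDefs
import Summits.ValiantsHypothesis.ValiantsHypothesis.Theorems.LacunarySymmetroidMatrixDescartesDegreeCeiling

/-!
# Tower graft line — the graft floor lemma IN PENCIL CURRENCY: corner graft `+ (W + 1)`, diagonal completion `+ 1`,
# i.e. `ζ₊(2; snoc d D) ≥ Z + W + 2` for all far exponents `D ≥ D₀`

Companion of `…TowerGraftGraftFloorLemma` (polynomial level).  For a real symmetric `2 × 2` pencil `G₀ = ∑ X^{d l} S l` on `d`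
(`K` letters) write `p = det G₀`, `f = (G₀)₀₀`, `g = (G₀)₁₁`.  Grafting the far letter `X^D · diag(s, e)` gives (`det_snoc_diag`)
`det = (p + s·X^D·g) + e·X^D·(f + s·X^D)`: a CORNER graft (`e = 0`, multiplier the OTHER diagonal entry) followed by a COMPLETION
term of larger degree.  Hence, in the census currency `PosRootLawOn`:

* ★ `corner_graft_floor` — if `det G₀` alternates on `Z + 1` points left of a cut `ρ` and the entry `g` alternates on `W + 1` points right
  of it (junction sign available by `GraftFloor.exists_sign_junction`), then `∃ D₀ ∀ D ≥ D₀ : ¬ PosRootLawOn 2 (K+1) (Z+W) (Fin.snoc d D)`,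
  i.e. `ζ₊(2; d ⊔ D) ≥ Z + W + 1` (rank-one top letter `diag(σρ^{−D}, 0)`);
* ★ `diag_graft_floor` — the same with the completed top letter `diag(σρ^{−D}, ε)`: `¬ PosRootLawOn 2 (K+1) (Z+W+1) (Fin.snoc d D)`,
  i.e. **`ζ₊(2; d ⊔ D) ≥ Z + W + 2` for every far exponent `D ≥ D₀`** (degree bookkeeping: `deg(p + sX^Dg) ≤ D + max d < 2D =
  deg X^D(f + sX^D)` once `D > max d`, tree `DegreeCeiling.natDegree_det_pencil_le`);
* `det_snoc_diag`, `isSymm_snoc_diag` — bookkeeping.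

READING (prose): this is the kernel form of the cell pub-symmetroid's «rank-one far-letter graft + ε-completion» that produced every
located tower record at `m = 2` (`K = 4 → 5`: ladder nine on `(0,1,3,15)`, cut `ρ ≈ 1.3`, `Z = 8`, `W = 3` ⇒ `13` on `(0,1,3,15,D)`;
the census instance `D = 135` is `TowerRowTwoK5.not_posRootLawOn_two_five_twelve_tower`).  Versus the tree's all-format GRAFT LAW
(`Census.Graft.exists_alternating_succ`: `+m = +2` per letter at `m = 2`) the cut harvests `W + 2 ≤ K + 1` per letter.  What it does
NOT give: floors for EVERY far exponent `D > 2·max d` (only `D ≥ D₀(G₀)`), nor designs with large `Z + W` on every tower — the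
split-design problem named in the companion file.  HONEST FRAMING: elementary; NO stub of the line is claimed; nothing on `WeakLifting`,
Conjecture B, `MatrixDescartes` (18050) or `VP ≠ VNP`.  Def-free.  Seat: prover leafhand-val-kpluslogsqlaw-1 g4,
`--supports stmt-ValiantsHypothesis-19561`.  [folklore] `2 × 2` determinant expansion, degree bookkeeping.
-/

-- `Summit.ValiantsHypothesis.ValiantsHypothesis.…` repeats a component by the D-0017 layout
-- (single-conjunct summit), which the `dupNamespace` linter flags; the name is mandated.
set_option linter.dupNamespace false
set_option autoImplicit false

namespace Summit.ValiantsHypothesis.ValiantsHypothesis.Theorems.KPlusLogSqLaw.TowerGraft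

open Polynomial Finset
open scoped BigOperators
open Summit.ValiantsHypothesis.ValiantsHypothesis.Theorems.LacunarySymmetroidMatrixDescartes (PosRootLawOn)
open Summit.ValiantsHypothesis.ValiantsHypothesis.Theorems.SymmetroidDescartes (le_card_posRoots_of_alternating)

namespace GraftFloor

variable {K : ℕ}

/-- **The grafted determinant.**  Top letter `diag(s, e)` at exponent `D` on top of `G₀ = ∑ X^{d l} S l`:
`det = (det G₀ + s·X^D·(G₀)₁₁) + e·X^D·((G₀)₀₀ + s·X^D)`. [folklore] -/
theorem det_snoc_diag (d : Fin K → ℕ) (S : Fin K → Matrix (Fin 2) (Fin 2) ℝ) (D : ℕ) (s e : ℝ) :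
    (∑ l, (X : ℝ[X]) ^ (Fin.snoc d D : Fin (K + 1) → ℕ) l •
        ((Fin.snoc S !![s, 0; 0, e] : Fin (K + 1) → Matrix (Fin 2) (Fin 2) ℝ) l).map C).det =
      ((∑ l, (X : ℝ[X]) ^ d l • (S l).map C).det + C s * X ^ D * ∑ l, X ^ d l * C (S l 1 1)) +
        C e * (X ^ D * ((∑ l, X ^ d l * C (S l 0 0)) + C s * X ^ D)) := by
  rw [Fin.sum_univ_castSucc]
  simp only [Fin.snoc_castSucc, Fin.snoc_last]
  rw [Matrix.det_fin_two, Matrix.det_fin_two]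
  simp [Matrix.sum_apply]
  ring

/-- the grafted letters are symmetric. [folklore] -/
theorem isSymm_snoc_diag (S : Fin K → Matrix (Fin 2) (Fin 2) ℝ) (hS : ∀ l, (S l).IsSymm) (s e : ℝ) :
    ∀ l, ((Fin.snoc S !![s, 0; 0, e] : Fin (K + 1) → Matrix (Fin 2) (Fin 2) ℝ) l).IsSymm := by
  intro l
  induction l using Fin.lastCases with
  | last =>
    rw [Fin.snoc_last]
    exact Matrix.IsSymm.ext fun i j => by fin_cases i <;> fin_cases j <;> simp
  | cast i =>
    rw [Fin.snoc_castSucc]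
    exact hS i

/-- ★ **CORNER GRAFT FLOOR** (rank-one top letter).  `det G₀` alternating (non-zero) on `0 < τ₀ < ⋯ < τ_Z < ρ`, the diagonal entry
`(G₀)₁₁` alternating (non-zero) on `ρ < τ'₀ < ⋯ < τ'_W`, junction sign `σ` ⟹ for all far exponents `D ≥ D₀` the `(K+1)`-letter support
`Fin.snoc d D` carries a symmetric pencil with `≥ Z + W + 1` positive determinant roots: `¬ PosRootLawOn 2 (K+1) (Z + W) (Fin.snoc d D)`.
[this work] -/
theorem corner_graft_floor {Z W : ℕ} (d : Fin K → ℕ) (S : Fin K → Matrix (Fin 2) (Fin 2) ℝ) (hS : ∀ l, (S l).IsSymm)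
    (τ : Fin (Z + 1) → ℝ) (τ' : Fin (W + 1) → ℝ) (ρ σ : ℝ)
    (hτm : StrictMono τ) (hτ'm : StrictMono τ') (hτ0 : 0 < τ 0) (hτρ : τ (Fin.last Z) < ρ) (hρτ' : ρ < τ' 0)
    (hp0 : ∀ i, (∑ l, (X : ℝ[X]) ^ d l • (S l).map C).det.eval (τ i) ≠ 0)
    (hq0 : ∀ j, (∑ l, (X : ℝ[X]) ^ d l * C (S l 1 1)).eval (τ' j) ≠ 0)
    (hp : ∀ i : Fin Z, (∑ l, (X : ℝ[X]) ^ d l • (S l).map C).det.eval (τ i.castSucc) *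
      (∑ l, (X : ℝ[X]) ^ d l • (S l).map C).det.eval (τ i.succ) < 0)
    (hq : ∀ j : Fin W, (∑ l, (X : ℝ[X]) ^ d l * C (S l 1 1)).eval (τ' j.castSucc) *
      (∑ l, (X : ℝ[X]) ^ d l * C (S l 1 1)).eval (τ' j.succ) < 0)
    (hσ : σ = 1 ∨ σ = -1)
    (hjunc : (∑ l, (X : ℝ[X]) ^ d l • (S l).map C).det.eval (τ (Fin.last Z)) *
      (σ * (∑ l, (X : ℝ[X]) ^ d l * C (S l 1 1)).eval (τ' 0)) < 0) :
    ∃ D₀ : ℕ, ∀ D : ℕ, D₀ ≤ D → ¬ PosRootLawOn 2 (K + 1) (Z + W) (Fin.snoc d D : Fin (K + 1) → ℕ) := by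
  obtain ⟨D₀, hD₀⟩ := le_card_posRoots_graft _ _ τ τ' ρ σ hτm hτ'm hτ0 hτρ hρτ' hp0 hq0 hp hq hσ hjunc
  refine ⟨D₀, fun D hD hlaw => ?_⟩
  have hcount := hD₀ D hD
  have hle := hlaw _ (isSymm_snoc_diag S hS (σ * (ρ⁻¹) ^ D) 0)
  rw [det_snoc_diag, map_zero, zero_mul, add_zero] at hle
  omega

/-- degree of the corner-grafted determinant: `≤ D + max d` once `D ≥ max d`. [folklore] -/
theorem natDegree_corner_le (d : Fin K → ℕ) (S : Fin K → Matrix (Fin 2) (Fin 2) ℝ) (D dmax : ℕ) (s : ℝ)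
    (hd : ∀ l, d l ≤ dmax) (hD : dmax ≤ D) :
    ((∑ l, (X : ℝ[X]) ^ d l • (S l).map C).det + C s * X ^ D * ∑ l, X ^ d l * C (S l 1 1)).natDegree ≤ D + dmax := by
  have h1 : (∑ l, (X : ℝ[X]) ^ d l • (S l).map C).det.natDegree ≤ 2 * dmax :=
    LacunarySymmetroidMatrixDescartes.DegreeCeiling.natDegree_det_pencil_le d S dmax hd
  have h2 : (∑ l, (X : ℝ[X]) ^ d l * C (S l 1 1)).natDegree ≤ dmax := by
    refine natDegree_sum_le_of_forall_le _ _ fun l _ => ?_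
    calc (X ^ d l * C (S l 1 1)).natDegree ≤ (X ^ d l : ℝ[X]).natDegree + (C (S l 1 1)).natDegree := natDegree_mul_le
      _ ≤ d l + 0 := by rw [natDegree_X_pow, natDegree_C]
      _ ≤ dmax := by simpa using hd l
  have h3 : (C s * X ^ D * ∑ l, X ^ d l * C (S l 1 1)).natDegree ≤ D + dmax := by
    calc (C s * X ^ D * ∑ l, X ^ d l * C (S l 1 1)).natDegree
        ≤ (C s * X ^ D : ℝ[X]).natDegree + (∑ l, X ^ d l * C (S l 1 1)).natDegree := natDegree_mul_le
      _ ≤ D + dmax := by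
          have : (C s * X ^ D : ℝ[X]).natDegree ≤ D := natDegree_C_mul_X_pow_le s D
          omega
  calc _ ≤ max (∑ l, (X : ℝ[X]) ^ d l • (S l).map C).det.natDegree
        (C s * X ^ D * ∑ l, X ^ d l * C (S l 1 1)).natDegree := natDegree_add_le _ _
    _ ≤ D + dmax := max_le (by omega) h3

/-- degree of the completion term: `natDegree (X^D · ((G₀)₀₀ + s·X^D)) = 2D` for `s ≠ 0`, `D > max d`. [folklore] -/
theorem natDegree_completion_eq (d : Fin K → ℕ) (S : Fin K → Matrix (Fin 2) (Fin 2) ℝ) (D dmax : ℕ) (s : ℝ) (hs : s ≠ 0)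
    (hd : ∀ l, d l ≤ dmax) (hD : dmax < D) :
    (X ^ D * ((∑ l, (X : ℝ[X]) ^ d l * C (S l 0 0)) + C s * X ^ D)).natDegree = D + D := by
  have h2 : (∑ l, (X : ℝ[X]) ^ d l * C (S l 0 0)).natDegree ≤ dmax := by
    refine natDegree_sum_le_of_forall_le _ _ fun l _ => ?_
    calc (X ^ d l * C (S l 0 0)).natDegree ≤ (X ^ d l : ℝ[X]).natDegree + (C (S l 0 0)).natDegree := natDegree_mul_le
      _ ≤ d l + 0 := by rw [natDegree_X_pow, natDegree_C]
      _ ≤ dmax := by simpa using hd l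
  have h4 : (C s * X ^ D : ℝ[X]).natDegree = D := natDegree_C_mul_X_pow D s hs
  have h5 : ((∑ l, (X : ℝ[X]) ^ d l * C (S l 0 0)) + C s * X ^ D).natDegree = D := by
    rw [natDegree_add_eq_right_of_natDegree_lt (by rw [h4]; omega), h4]
  have hne : ((∑ l, (X : ℝ[X]) ^ d l * C (S l 0 0)) + C s * X ^ D) ≠ 0 := by
    intro h0
    have := congrArg natDegree h0
    rw [h5, natDegree_zero] at this
    omega
  rw [natDegree_mul (pow_ne_zero D X_ne_zero) hne, natDegree_X_pow, h5]

/-- ★ **DIAGONAL (COMPLETED) GRAFT FLOOR.**  Under the hypotheses of `corner_graft_floor`, for all far exponents `D ≥ D₀` the support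
`Fin.snoc d D` carries a symmetric pencil (top letter `diag(σρ^{−D}, ε)`) with `≥ Z + W + 2` positive determinant roots:
`¬ PosRootLawOn 2 (K+1) (Z + W + 1) (Fin.snoc d D)`.  (Corner graft `+ (W+1)`, completion `+ 1`.) [this work] -/
theorem diag_graft_floor {Z W : ℕ} (d : Fin K → ℕ) (S : Fin K → Matrix (Fin 2) (Fin 2) ℝ) (hS : ∀ l, (S l).IsSymm)
    (τ : Fin (Z + 1) → ℝ) (τ' : Fin (W + 1) → ℝ) (ρ σ : ℝ)
    (hτm : StrictMono τ) (hτ'm : StrictMono τ') (hτ0 : 0 < τ 0) (hτρ : τ (Fin.last Z) < ρ) (hρτ' : ρ < τ' 0)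
    (hp0 : ∀ i, (∑ l, (X : ℝ[X]) ^ d l • (S l).map C).det.eval (τ i) ≠ 0)
    (hq0 : ∀ j, (∑ l, (X : ℝ[X]) ^ d l * C (S l 1 1)).eval (τ' j) ≠ 0)
    (hp : ∀ i : Fin Z, (∑ l, (X : ℝ[X]) ^ d l • (S l).map C).det.eval (τ i.castSucc) *
      (∑ l, (X : ℝ[X]) ^ d l • (S l).map C).det.eval (τ i.succ) < 0)
    (hq : ∀ j : Fin W, (∑ l, (X : ℝ[X]) ^ d l * C (S l 1 1)).eval (τ' j.castSucc) *
      (∑ l, (X : ℝ[X]) ^ d l * C (S l 1 1)).eval (τ' j.succ) < 0)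
    (hσ : σ = 1 ∨ σ = -1)
    (hjunc : (∑ l, (X : ℝ[X]) ^ d l • (S l).map C).det.eval (τ (Fin.last Z)) *
      (σ * (∑ l, (X : ℝ[X]) ^ d l * C (S l 1 1)).eval (τ' 0)) < 0) :
    ∃ D₀ : ℕ, ∀ D : ℕ, D₀ ≤ D → ¬ PosRootLawOn 2 (K + 1) (Z + W + 1) (Fin.snoc d D : Fin (K + 1) → ℕ) := by
  obtain ⟨D₀, hD₀⟩ := exists_alternating_graft _ _ τ τ' ρ σ hτm hτ'm hτ0 hτρ hρτ' hp0 hq0 hp hq hσ hjunc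
  -- a bound for the old exponents
  set dmax : ℕ := ∑ l, d l with hdmax
  have hd : ∀ l, d l ≤ dmax := fun l => Finset.single_le_sum (fun k _ => Nat.zero_le (d k)) (Finset.mem_univ l)
  have hρ : 0 < ρ := (hτ0.trans_le (hτm.monotone (Fin.zero_le _))).trans hτρ
  refine ⟨D₀ + (dmax + 1), fun D hD hlaw => ?_⟩
  obtain ⟨u, hu, hupos, hune, halt⟩ := hD₀ D (by omega)
  have hs : σ * (ρ⁻¹) ^ D ≠ 0 := by
    rcases hσ with rfl | rfl
    · exact mul_ne_zero one_ne_zero (pow_ne_zero _ (inv_ne_zero hρ.ne'))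
    · exact mul_ne_zero (by norm_num) (pow_ne_zero _ (inv_ne_zero hρ.ne'))
  have hdeg : ((∑ l, (X : ℝ[X]) ^ d l • (S l).map C).det +
        C (σ * (ρ⁻¹) ^ D) * X ^ D * ∑ l, X ^ d l * C (S l 1 1)).natDegree <
      (X ^ D * ((∑ l, (X : ℝ[X]) ^ d l * C (S l 0 0)) + C (σ * (ρ⁻¹) ^ D) * X ^ D)).natDegree := by
    rw [natDegree_completion_eq d S D dmax _ hs hd (by omega)]
    have := natDegree_corner_le d S D dmax (σ * (ρ⁻¹) ^ D) hd (by omega)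
    omega
  obtain ⟨ε, -, -, hcount⟩ := le_card_posRoots_complete _ _ u hu (hupos 0) hune halt hdeg
  have hle := hlaw _ (isSymm_snoc_diag S hS (σ * (ρ⁻¹) ^ D) ε)
  rw [det_snoc_diag] at hle
  omega

end GraftFloor

end Summit.ValiantsHypothesis.ValiantsHypothesis.Theorems.KPlusLogSqLaw.TowerGraft
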